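import Summits.FinalStateConjecture.FinalStateConjecture.Theorems.ZeroEnergyKerrOrBombHawkingExtensionIsKerrSECSection
import HarnessLib

/-!
# Crux `HawkingExtensionIsKerr` (stmt-FinalStateConjecture-17840), line `SketchIdeator2` —
# the conditional closer after programme SEC (lead c7)

Helper file of the line lead (c7), registered sub-goal `stub_sec_cruxOfFiveFacts`: the body of
`ZeroEnergyKerrOrBomb.HawkingExtensionIsKerr` (rev 9, VERBATIM) from the four classical uniqueness facts
(Sudarsky–Wald 1993 staticity, Chruściel–Galloway 2010 static uniqueness, Chruściel 1997 Thm 1.1 and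
Chruściel–Costa–Heusler 2012 Thm 3.2 at d.o.c. level) and the verbatim topological fact
`chruscielWald1994_crossSectionSphere` (Chruściel–Wald 1994 Thm 2.3 (2) = CC08 Cor 2.5, p168123) — the
strategist glue `hawkingExtensionIsKerr_of_subs` (…Split.lean p163089) at child A PROVED by programme SEC
(`stub_sec_childA`, …SECSection.lean p169826) and child B from the four facts
(`nondegenerateHawkingExtensionIsKerr_of_four_facts`).  This is the exact conditional re-filing target of
the crux after c7 (it supersedes c5's `hawkingExtensionIsKerr_of_five_facts'` and c6's
`hawkingExtensionIsKerr_of_four_facts_of_immersedSphere`, whose fifth hypothesis was the composite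
smooth-section fact resp. the weak section statement): the smoothing is now a theorem.
-/

noncomputable section

set_option linter.dupNamespace false

namespace Summit.FinalStateConjecture.FinalStateConjecture.Theorems.HawkingExtensionIsKerr.SketchIdeator2

open Set Literature.Geometry.Lorentzian
open scoped Manifold ContDiff Topology

/-- **The crux body from four uniqueness facts and the topological fact (registered sub-goal, closed
statement).**  `hawkingExtensionIsKerr_of_subs (stub_sec_childA h₅) (nondegenerateHawkingExtensionIsKerr_of_four_facts h₁ h₂ h₃ h₄)`. -/
theorem stub_sec_cruxOfFiveFacts : SudarskyWald1993_staticity → ChruscielGalloway2010_docStaticUniqueness → Chrusciel1997_docAxisymmetricCombination → ChruscielCostaHeusler2012_docAxisymmetricUniqueness → chruscielWald1994_crossSectionSphere → ∀ (𝓑 : Literature.Geometry.Lorentzian.StationaryAFBlackHole.{0}) [𝓑.metric.HasLeviCivita] [Literature.Geometry.Lorentzian.Kerr.Facts], 𝓑.metric.toPseudoRiemannianMetric.IsRicciFlat → 𝓑.IsIPlusRegular → (∀ p : 𝓑.carrier, p ∈ 𝓑.metric.chronologicalFuture 𝓑.timeOrientation 𝓑.Mext) → (∀ p ∈ 𝓑.doc,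 𝓑.killing p ≠ 0) → SimplyConnectedSpace 𝓑.doc → ∀ (U : Set 𝓑.carrier) (K : Π x : 𝓑.carrier, TangentSpace (𝓡 4) x), IsOpen U → 𝓑.horizon ⊆ U → IsConnected 𝓑.horizon → ContMDiffOn (𝓡 4) ((𝓡 4).prod 𝓘(ℝ, Literature.Geometry.Lorentzian.E4)) ((⊤ : ℕ∞) : WithTop ℕ∞) (fun x ↦ (Bundle.TotalSpace.mk' Literature.Geometry.Lorentzian.E4 x (K x) : TangentBundle (𝓡 4) 𝓑.carrier)) U → (∀ x ∈ U, ∀ v w : TangentSpace (𝓡 4) x, 𝓑.metric.val x (𝓑.metric.leviCivita K x v) w + 𝓑.metric.val x v (𝓑.metric.leviCivita K x w) = 0) → (∀ x ∈ U, VectorField.mlieBracket (𝓡 4) 𝓑.killing K x = 0) → (∀ p ∈ 𝓑.horizon, K p ≠ 0) → (∀ γ : ℝ → 𝓑.carrier, IsMIntegralCurve γ K → γ 0 ∈ 𝓑.horizon → ∀ t, γ t ∈ 𝓑.horizon) → (∀ x ∈ U ∩ 𝓑.doc, 𝓑.metric.val x (K x) (K x) < 0) → (∃ K' : Π x : 𝓑.carrier,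 TangentSpace (𝓡 4) x, ContMDiffOn (𝓡 4) ((𝓡 4).prod 𝓘(ℝ, Literature.Geometry.Lorentzian.E4)) ((⊤ : ℕ∞) : WithTop ℕ∞) (fun x ↦ (Bundle.TotalSpace.mk' Literature.Geometry.Lorentzian.E4 x (K' x) : TangentBundle (𝓡 4) 𝓑.carrier)) 𝓑.doc ∧ (∀ x ∈ 𝓑.doc, ∀ v w : TangentSpace (𝓡 4) x, 𝓑.metric.val x (𝓑.metric.leviCivita K' x v) w + 𝓑.metric.val x v (𝓑.metric.leviCivita K' x w) = 0) ∧ (∀ x ∈ 𝓑.doc, VectorField.mlieBracket (𝓡 4) 𝓑.killing K' x = 0) ∧ ∃ U' : Set 𝓑.carrier, IsOpen U' ∧ 𝓑.horizon ⊆ U' ∧ ∀ x ∈ U' ∩ 𝓑.doc, K' x = K x) → ∃ (M a : ℝ), Literature.Geometry.Lorentzian.Kerr.IsSubextremal M a ∧ ∃ Ψ : Literature.Geometry.Lorentzian.Kerr.exterior M a → 𝓑.carrier, Function.Injective Ψ ∧ Set.range Ψ = 𝓑.doc ∧ Literature.Geometry.Lorentzian.PseudoRiemannianMetric.IsIsometricImmersion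 (Literature.Geometry.Lorentzian.Kerr.smoothMetric M a (Literature.Geometry.Lorentzian.Kerr.rPlus M a)).toPseudoRiemannianMetric 𝓑.metric.toPseudoRiemannianMetric Ψ :=
  fun h₁ h₂ h₃ h₄ h₅ ↦ hawkingExtensionIsKerr_of_subs (stub_sec_childA h₅)
    (nondegenerateHawkingExtensionIsKerr_of_four_facts h₁ h₂ h₃ h₄)

end Summit.FinalStateConjecture.FinalStateConjecture.Theorems.HawkingExtensionIsKerr.SketchIdeator2

end
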